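import Summits.QuantumFields.BalabanUV.T4Continuum.Support.ReplicationRightInverseBound
import Summits.QuantumFields.BalabanUV.T4Continuum.Support.NE3CovariantLineSumsError
import HarnessLib

/-!
# NE3TopRadiusLetters (T⁴ programme, node NE3, row NE3-R2 — junction reader of route H♮, kernel K-g10-1) — THE TOP RADIUS OF THE
# AVERAGING TOWER IS THE REGIME'S ε UP TO 1∕16, AND THE `E_j ≤ 1∕2` LINE OF THE NESTED FIX IS IMPLIED BY `LevelSmall` ALONE

Row NE3-R2 OWNER lineage `b2b-balaban-t4-ne3r2-p1` (gen 10), disprover ∕ junction reader of the K6 assembly of route H♮ (owner ruling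
ρ-g22-2; blueprint ρ-g23-3).  CONTEXT.  The K-road files display their smallness in the letters `x` (the FINE plaquette radius,
`SmallField W x`), `LevelSmall d L j x` and the TOP radius `r_j := (prop1Radius d L)^[j] x` through `loopRad d L r_j`
(J2 `NE3NestedBlockMeanBridge.norm_bmeanIterW_sub_bmeanW_le`, J4 `NE3TowerBondVsSegment.norm_cavgIter_sub_bseg_le_top`, K6b-1, K6-face,
K6b-3), while the regime speaks the COARSE letter `ε = (L^{j+1})²·x` (`x = ε∕(L^{j+1})²`, cf. `NE3CurlPairedResidualSpread.small512_of_levelSmall`)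
and the junction `ne3EnergyRateWSup_of_slicePoincare` wants ONE k-free constant.  THIS FILE closes the two conversions in the kernel
(all [folklore], real-number bookkeeping, 0 def, 0 sorry):
§1 `radIter_eq_iterate` (`AveragingDeficitMultiLevelPrep.radIter d L j x = (prop1Radius d L)^[j] x`), `radIter_le_radSum`,
   **`pow_mul_le_iterate_prop1Radius`** (`(L²)^j·x ≤ r_j`, `sq_mul_le_prop1Radius` iterated) and its respelling `sq_pow_mul_le_sq_mul_iterate`
   (`(L^{j+1})²·x ≤ L²·r_j`);
§2 **`E_le_half_of_levelSmall`**: `LevelSmall d L j x ⇒ 4d²(L^{j+1} − 1)²x + 16d·loopRad d L r_j ≤ 1∕2` (`L ≥ 1`, `x ≥ 0`) — VERBATIM the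
   hypothesis `hE` of files 6b `NE3CompetitorNestedFix` ∕ 6c `NE3CompetitorSlice` (leaf-01-g6), so the K6 assembler discharges it BY NAME from
   the class (`E_j ≤ (4d² + 256d(d+1)(d+4))·L²·r_j ≤ 260∕65536`);
§3 **`iterate_prop1Radius_le_of_levelSmall`**: `LevelSmall d L j x ⇒ r_j ≤ (17∕16)·(L²)^j·x` (`L ≥ 2`, `x ≥ 0`; products `Π(1 + c₁L²r_i)`,
   `c₁ = 14464(d+1)²(d+4)²`, with `Σ_{i<j} r_i ≤ r_j∕3` from `ReplicationRightInverseBound.radSum_le` and `twoLevelSmall·r_j ≤ 1` — the pattern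
   of `liftConst_le_radSum`), and the letters that follow: **`loopRad_iterate_le_of_levelSmall`** (`loopRad d L r_j ≤ 17(d+1)(d+4)·(L^{j+1})²x`),
   **`E_le_of_levelSmall`** (`E_j ≤ (4d² + 272d(d+1)(d+4))·(L^{j+1})²x`);
§4 one level (`prop1Radius_le_of_twoLevelSmall`: `prop1Radius d L y ≤ (17∕16)·L²y` under `twoLevelSmall·y ≤ 1`) and THE JUNCTION'S DICTIONARY
   **`sq_pow_mul_prop1Radius_le`**: `(L^{j+1})²·prop1Radius d L (ε∕(L^{j+2})²) ≤ (17∕16)·ε` — the K-road letter of the background `W = cavg L U_B`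
   of `NE3EnergyRateWSupOfSlicePoincare.ne3EnergyRateWSup_sfClass_of_slicePoincare` (levels `j+1`∕`j+2`, run B's radius `ε∕(L^{j+2})²`) IS `ε` up to 1∕16.
HONEST FRAMING.  Arithmetic of OUR averaging radii; nothing about Bałaban's minimisers; (P♮)_W, (ML_w) at `W ≠ 1`, T-E_w and NE3 are NOT
proved; spine PROVED 0∕9; finite T⁴ rung (B)+1 — NOT infinite volume, NOT mass gap, NOT BetaPertH, NOT Clay.  ABSOLUTE RULE kept (no
printed sentence is a hypothesis; context only: [Balaban1985Averaging] Prop. 1 p. 24).  PLACEMENT: `Summits/QuantumFields/BalabanUV/`;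
imports accepted modules only; moves nothing.  HONEST DEPENDENCY: continuum YM on T⁴ ⇐ BetaPertH ∧ nine spine estimates (0/9 proved);
BetaPertH ⇐ (D1) ∧ (D4) ∧ CAP+tail; G-an2-4 gates asym, D1 and NE2/3/4.
-/

set_option autoImplicit false

namespace Summit.QuantumFields.BalabanUV.T4Continuum.NE3TopRadiusLetters

open Literature.MathematicalPhysics.QuantumFieldTheory.Balaban1983to89
open AveragingDeficitTwoLevelPrep (twoLevelSmall prop1Radius)
open AveragingDeficitMultiLevelPrep (LevelSmall radIter prop1Radius_nonneg)
open ReplicationRightInverseBound (radSum radSum_le)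
open NE3CovariantLineSumsError (sq_mul_le_prop1Radius iterate_prop1Radius_nonneg)
open SpreadLift (loopRad)

noncomputable section

variable {d : ℕ}

/-! ## §1 The top radius against `(L²)^j·x` from below -/

/-- `radIter` IS the iterate: `radIter d L j x = (prop1Radius d L)^[j] x`. [folklore] -/
theorem radIter_eq_iterate (L : ℕ) : ∀ (j : ℕ) (x : ℝ), radIter d L j x = (prop1Radius d L)^[j] x
  | 0, _ => rfl
  | j + 1, x => by
      rw [Function.iterate_succ_apply]
      exact radIter_eq_iterate L j (prop1Radius d L x)

/-- The top radius is one of the summands of `radSum`: `radIter d L j x ≤ radSum d L j x` (`x ≥ 0`). [folklore] -/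
theorem radIter_le_radSum (L : ℕ) : ∀ (j : ℕ) {x : ℝ}, 0 ≤ x → radIter d L j x ≤ radSum d L j x
  | 0, _, _ => le_rfl
  | j + 1, x, hx => by
      show radIter d L j (prop1Radius d L x) ≤ x + radSum d L j (prop1Radius d L x)
      have ih := radIter_le_radSum L j (prop1Radius_nonneg (d := d) (L := L) hx)
      linarith

/-- **THE RADII GROW AT LEAST BY `L²` PER LEVEL**: `(L²)^j·x ≤ (prop1Radius d L)^[j] x` (no sign hypothesis needed). [folklore] -/
theorem pow_mul_le_iterate_prop1Radius (L : ℕ) : ∀ (j : ℕ) (x : ℝ), ((L : ℝ) ^ 2) ^ j * x ≤ (prop1Radius d L)^[j] x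
  | 0, x => by simp
  | j + 1, x => by
      rw [Function.iterate_succ_apply', pow_succ]
      have ih := pow_mul_le_iterate_prop1Radius L j x
      have h1 := sq_mul_le_prop1Radius (d := d) L ((prop1Radius d L)^[j] x)
      have hL : (0 : ℝ) ≤ (L : ℝ) ^ 2 := by positivity
      calc ((L : ℝ) ^ 2) ^ j * (L : ℝ) ^ 2 * x = (L : ℝ) ^ 2 * (((L : ℝ) ^ 2) ^ j * x) := by ring
        _ ≤ (L : ℝ) ^ 2 * (prop1Radius d L)^[j] x := mul_le_mul_of_nonneg_left ih hL
        _ ≤ prop1Radius d L ((prop1Radius d L)^[j] x) := h1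

/-- Respelling in the coarse letter: `(L^{j+1})²·x ≤ L²·r_j`. [folklore] -/
theorem sq_pow_mul_le_sq_mul_iterate (L : ℕ) (j : ℕ) (x : ℝ) :
    ((L : ℝ) ^ (j + 1)) ^ 2 * x ≤ (L : ℝ) ^ 2 * (prop1Radius d L)^[j] x := by
  have h := pow_mul_le_iterate_prop1Radius (d := d) L j x
  have hL : (0 : ℝ) ≤ (L : ℝ) ^ 2 := by positivity
  calc ((L : ℝ) ^ (j + 1)) ^ 2 * x = (L : ℝ) ^ 2 * (((L : ℝ) ^ 2) ^ j * x) := by ring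
    _ ≤ (L : ℝ) ^ 2 * (prop1Radius d L)^[j] x := mul_le_mul_of_nonneg_left h hL

/-! ## §2 The `E_j ≤ 1∕2` line of the nested fix is implied by `LevelSmall` -/

/-- `E_j` against the top radius: `4d²(L^{j+1} − 1)²x + 16d·loopRad d L r_j ≤ (4d² + 256d(d+1)(d+4))·(L²·r_j)` (`L ≥ 1`, `x ≥ 0`). [folklore] -/
theorem E_le_sq_mul_iterate {L : ℕ} (hL : 1 ≤ L) (j : ℕ) {x : ℝ} (hx : 0 ≤ x) :
    4 * (d : ℝ) ^ 2 * ((L : ℝ) ^ (j + 1) - 1) ^ 2 * x + 16 * d * loopRad d L ((prop1Radius d L)^[j] x)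
      ≤ (4 * (d : ℝ) ^ 2 + 256 * d * (((d : ℝ) + 1) * ((d : ℝ) + 4))) * ((L : ℝ) ^ 2 * (prop1Radius d L)^[j] x) := by
  have hlow := sq_pow_mul_le_sq_mul_iterate (d := d) L j x
  have hL1 : (1 : ℝ) ≤ L := by exact_mod_cast hL
  have hp : (1 : ℝ) ≤ (L : ℝ) ^ (j + 1) := one_le_pow₀ hL1
  have hA : ((L : ℝ) ^ (j + 1) - 1) ^ 2 * x ≤ (L : ℝ) ^ 2 * (prop1Radius d L)^[j] x := by
    have h1 : ((L : ℝ) ^ (j + 1) - 1) ^ 2 ≤ ((L : ℝ) ^ (j + 1)) ^ 2 := by nlinarith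
    exact (mul_le_mul_of_nonneg_right h1 hx).trans hlow
  have hd0 : (0 : ℝ) ≤ 4 * (d : ℝ) ^ 2 := by positivity
  have hB := mul_le_mul_of_nonneg_left hA hd0
  unfold loopRad
  nlinarith [hB]

/-- **`hE` OF THE NESTED FIX FROM THE CLASS**: `LevelSmall d L j x ⇒ 4d²(L^{j+1} − 1)²x + 16d·loopRad d L ((prop1Radius d L)^[j] x) ≤ 1∕2`
(`L ≥ 1`, `x ≥ 0`) — verbatim the hypothesis `hE` of `NE3CompetitorNestedFix` ∕ `NE3CompetitorSlice`; indeed `≤ 260∕65536`. [folklore] -/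
theorem E_le_half_of_levelSmall {L : ℕ} (hL : 1 ≤ L) (j : ℕ) {x : ℝ} (hx : 0 ≤ x) (hs : LevelSmall d L j x) :
    4 * (d : ℝ) ^ 2 * ((L : ℝ) ^ (j + 1) - 1) ^ 2 * x + 16 * d * loopRad d L ((prop1Radius d L)^[j] x) ≤ 1 / 2 := by
  refine (E_le_sq_mul_iterate hL j hx).trans ?_
  set r := (prop1Radius d L)^[j] x with hr
  have hr0 : 0 ≤ r := iterate_prop1Radius_nonneg (d := d) j hx
  have htop : twoLevelSmall d L * r ≤ 1 := NE3CovariantLineSumsError.LevelSmall.top hs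
  unfold twoLevelSmall at htop
  have hL1 : (1 : ℝ) ≤ L := by exact_mod_cast hL
  have hd : (0 : ℝ) ≤ d := Nat.cast_nonneg d
  -- the constant: `4d² + 256d(d+1)(d+4) ≤ 260·((d+1)(d+4))²`
  have hP1 : (d : ℝ) ≤ ((d : ℝ) + 1) * ((d : ℝ) + 4) := by nlinarith
  have hP0 : (0 : ℝ) ≤ ((d : ℝ) + 1) * ((d : ℝ) + 4) := by positivity
  have hK : 4 * (d : ℝ) ^ 2 + 256 * d * (((d : ℝ) + 1) * ((d : ℝ) + 4)) ≤ 260 * (((d : ℝ) + 1) * ((d : ℝ) + 4)) ^ 2 := by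
    nlinarith [mul_le_mul_of_nonneg_right hP1 hP0, mul_le_mul_of_nonneg_right hP1 hd]
  -- the powers of `L`: `L² ≤ L^{d+4}`
  have hLpow : (L : ℝ) ^ 2 ≤ (L : ℝ) ^ (d + 4) := pow_le_pow_right₀ hL1 (by omega)
  have h2 : (L : ℝ) ^ 2 * r ≤ (L : ℝ) ^ (d + 4) * r := mul_le_mul_of_nonneg_right hLpow hr0
  have hK0 : (0 : ℝ) ≤ 4 * (d : ℝ) ^ 2 + 256 * d * (((d : ℝ) + 1) * ((d : ℝ) + 4)) := by positivity
  have hLr : (0 : ℝ) ≤ (L : ℝ) ^ (d + 4) * r := by positivity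
  calc (4 * (d : ℝ) ^ 2 + 256 * d * (((d : ℝ) + 1) * ((d : ℝ) + 4))) * ((L : ℝ) ^ 2 * r)
      ≤ (4 * (d : ℝ) ^ 2 + 256 * d * (((d : ℝ) + 1) * ((d : ℝ) + 4))) * ((L : ℝ) ^ (d + 4) * r) :=
        mul_le_mul_of_nonneg_left h2 hK0
    _ ≤ 260 * (((d : ℝ) + 1) * ((d : ℝ) + 4)) ^ 2 * ((L : ℝ) ^ (d + 4) * r) := mul_le_mul_of_nonneg_right hK hLr
    _ = 260 / 65536 * (65536 * ((d : ℝ) + 1) ^ 2 * ((d : ℝ) + 4) ^ 2 * (L : ℝ) ^ (d + 4) * r) := by ring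
    _ ≤ 260 / 65536 * 1 := mul_le_mul_of_nonneg_left htop (by norm_num)
    _ ≤ 1 / 2 := by norm_num

/-! ## §3 The top radius against `(L²)^j·x` from above: the product of the level factors -/

/-- `prop1Radius` in product form: `prop1Radius d L y = L²·y·(1 + 14464(d+1)²(d+4)²·L²·y)`. [folklore] -/
theorem prop1Radius_eq_mul (L : ℕ) (y : ℝ) :
    prop1Radius d L y = (L : ℝ) ^ 2 * y * (1 + 14464 * ((d : ℝ) + 1) ^ 2 * ((d : ℝ) + 4) ^ 2 * (L : ℝ) ^ 2 * y) := by
  unfold prop1Radius; ring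

/-- THE PRODUCT STEP (induction on the number of levels, all radii `x ≥ 0`): if the lower radii satisfy
`c₁L²·Σ_{i<j} r_i ≤ 1∕2` (`Σ_{i<j} r_i = radSum − radIter`, `c₁ = 14464(d+1)²(d+4)²`), then
`r_j ≤ (L²)^j·x·(1 + 2·c₁L²·Σ_{i<j} r_i)` (`(1+a)(1+2b) ≤ 1 + 2a + 2b` for `a ≥ 0`, `b ≤ 1∕2`). [folklore] -/
theorem radIter_le_of_lowSum (L : ℕ) : ∀ (j : ℕ) {x : ℝ}, 0 ≤ x →
    14464 * ((d : ℝ) + 1) ^ 2 * ((d : ℝ) + 4) ^ 2 * (L : ℝ) ^ 2 * (radSum d L j x - radIter d L j x) ≤ 1 / 2 →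
    radIter d L j x ≤ ((L : ℝ) ^ 2) ^ j * x
      * (1 + 2 * (14464 * ((d : ℝ) + 1) ^ 2 * ((d : ℝ) + 4) ^ 2 * (L : ℝ) ^ 2 * (radSum d L j x - radIter d L j x)))
  | 0, x, _, _ => by simp [radSum, radIter]
  | j + 1, x, hx, h => by
      simp only [radSum, radIter] at h ⊢
      have hpx : 0 ≤ prop1Radius d L x := prop1Radius_nonneg (d := d) (L := L) hx
      have hT0 : 0 ≤ radSum d L j (prop1Radius d L x) - radIter d L j (prop1Radius d L x) :=
        sub_nonneg.2 (radIter_le_radSum L j hpx)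
      have hc0 : (0 : ℝ) ≤ 14464 * ((d : ℝ) + 1) ^ 2 * ((d : ℝ) + 4) ^ 2 * (L : ℝ) ^ 2 := by positivity
      have hcx : 0 ≤ 14464 * ((d : ℝ) + 1) ^ 2 * ((d : ℝ) + 4) ^ 2 * (L : ℝ) ^ 2 * x := mul_nonneg hc0 hx
      have hcT : 0 ≤ 14464 * ((d : ℝ) + 1) ^ 2 * ((d : ℝ) + 4) ^ 2 * (L : ℝ) ^ 2
          * (radSum d L j (prop1Radius d L x) - radIter d L j (prop1Radius d L x)) := mul_nonneg hc0 hT0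
      have hT : 14464 * ((d : ℝ) + 1) ^ 2 * ((d : ℝ) + 4) ^ 2 * (L : ℝ) ^ 2
          * (radSum d L j (prop1Radius d L x) - radIter d L j (prop1Radius d L x)) ≤ 1 / 2 := by
        have e : x + radSum d L j (prop1Radius d L x) - radIter d L j (prop1Radius d L x)
            = x + (radSum d L j (prop1Radius d L x) - radIter d L j (prop1Radius d L x)) := by ring
        rw [e, mul_add] at h
        linarith
      have ih := radIter_le_of_lowSum L j hpx hT
      have hLj : (0 : ℝ) ≤ ((L : ℝ) ^ 2) ^ (j + 1) * x := by positivity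
      calc radIter d L j (prop1Radius d L x)
          ≤ ((L : ℝ) ^ 2) ^ j * prop1Radius d L x * (1 + 2 * (14464 * ((d : ℝ) + 1) ^ 2 * ((d : ℝ) + 4) ^ 2 * (L : ℝ) ^ 2
              * (radSum d L j (prop1Radius d L x) - radIter d L j (prop1Radius d L x)))) := ih
        _ = ((L : ℝ) ^ 2) ^ (j + 1) * x * ((1 + 14464 * ((d : ℝ) + 1) ^ 2 * ((d : ℝ) + 4) ^ 2 * (L : ℝ) ^ 2 * x)
              * (1 + 2 * (14464 * ((d : ℝ) + 1) ^ 2 * ((d : ℝ) + 4) ^ 2 * (L : ℝ) ^ 2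
                * (radSum d L j (prop1Radius d L x) - radIter d L j (prop1Radius d L x))))) := by
            rw [prop1Radius_eq_mul (d := d) L x]; ring
        _ ≤ ((L : ℝ) ^ 2) ^ (j + 1) * x * (1 + 2 * (14464 * ((d : ℝ) + 1) ^ 2 * ((d : ℝ) + 4) ^ 2 * (L : ℝ) ^ 2
              * (x + radSum d L j (prop1Radius d L x) - radIter d L j (prop1Radius d L x)))) := by
            apply mul_le_mul_of_nonneg_left _ hLj
            nlinarith [mul_le_mul_of_nonneg_left hT hcx]

/-- **THE TOP RADIUS IS THE COARSE LETTER UP TO 1∕16** (`L ≥ 2`, `x ≥ 0`): `LevelSmall d L j x ⇒ (prop1Radius d L)^[j] x ≤ (17∕16)·(L²)^j·x`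
— the lower radii sum to at most `r_j∕3` (`radSum_le`) and `twoLevelSmall·r_j ≤ 1` makes `2·c₁L²·(r_j∕3) ≤ 14464∕(3·65536·2) ≤ 1∕16`. [folklore] -/
theorem iterate_prop1Radius_le_of_levelSmall {L : ℕ} (hL : 2 ≤ L) (j : ℕ) {x : ℝ} (hx : 0 ≤ x) (hs : LevelSmall d L j x) :
    (prop1Radius d L)^[j] x ≤ 17 / 16 * (((L : ℝ) ^ 2) ^ j * x) := by
  rw [← radIter_eq_iterate]
  set r := radIter d L j x with hr
  have hsum := radSum_le (d := d) hL j hx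
  have htop : twoLevelSmall d L * r ≤ 1 := by
    rw [hr, radIter_eq_iterate]; exact NE3CovariantLineSumsError.LevelSmall.top hs
  unfold twoLevelSmall at htop
  have hr0 : 0 ≤ r := by rw [hr, radIter_eq_iterate]; exact iterate_prop1Radius_nonneg (d := d) j hx
  -- `Σ_{i<j} r_i ≤ r∕3`
  have hlow : radSum d L j x - r ≤ r / 3 := by rw [hr]; linarith
  -- `P·L²·r ≤ 1∕(4·65536)` from `65536·P·L^{d+4}·r ≤ 1` and `L^{d+4} ≥ 4·L²`
  have hL2 : (2 : ℝ) ≤ L := by exact_mod_cast hL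
  have hL1 : (1 : ℝ) ≤ L := by linarith
  have hLd : (L : ℝ) ^ 2 * 4 ≤ (L : ℝ) ^ (d + 4) := by
    have h4 : (4 : ℝ) ≤ (L : ℝ) ^ 2 := by nlinarith
    have hd2 : (L : ℝ) ^ 2 ≤ (L : ℝ) ^ (d + 2) := pow_le_pow_right₀ hL1 (by omega)
    calc (L : ℝ) ^ 2 * 4 ≤ (L : ℝ) ^ 2 * (L : ℝ) ^ 2 := mul_le_mul_of_nonneg_left h4 (by positivity)
      _ ≤ (L : ℝ) ^ (d + 2) * (L : ℝ) ^ 2 := mul_le_mul_of_nonneg_right hd2 (by positivity)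
      _ = (L : ℝ) ^ (d + 4) := by ring
  have hP0 : (0 : ℝ) ≤ ((d : ℝ) + 1) ^ 2 * ((d : ℝ) + 4) ^ 2 := by positivity
  have hcr : 14464 * ((d : ℝ) + 1) ^ 2 * ((d : ℝ) + 4) ^ 2 * (L : ℝ) ^ 2 * r ≤ 14464 / 262144 := by
    have h1 : ((d : ℝ) + 1) ^ 2 * ((d : ℝ) + 4) ^ 2 * ((L : ℝ) ^ 2 * 4) * r
        ≤ ((d : ℝ) + 1) ^ 2 * ((d : ℝ) + 4) ^ 2 * (L : ℝ) ^ (d + 4) * r :=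
      mul_le_mul_of_nonneg_right (mul_le_mul_of_nonneg_left hLd hP0) hr0
    nlinarith [h1, htop]
  have hc0 : (0 : ℝ) ≤ 14464 * ((d : ℝ) + 1) ^ 2 * ((d : ℝ) + 4) ^ 2 * (L : ℝ) ^ 2 := by positivity
  have hcS : 14464 * ((d : ℝ) + 1) ^ 2 * ((d : ℝ) + 4) ^ 2 * (L : ℝ) ^ 2 * (radSum d L j x - r) ≤ 14464 / 262144 / 3 := by
    have := mul_le_mul_of_nonneg_left hlow hc0
    linarith
  have hhalf : 14464 * ((d : ℝ) + 1) ^ 2 * ((d : ℝ) + 4) ^ 2 * (L : ℝ) ^ 2 * (radSum d L j x - r) ≤ 1 / 2 :=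
    hcS.trans (by norm_num)
  have hmain := radIter_le_of_lowSum (d := d) L j hx (by rw [← hr]; exact hhalf)
  rw [← hr] at hmain
  have hLj : (0 : ℝ) ≤ ((L : ℝ) ^ 2) ^ j * x := by positivity
  calc r ≤ ((L : ℝ) ^ 2) ^ j * x * (1 + 2 * (14464 * ((d : ℝ) + 1) ^ 2 * ((d : ℝ) + 4) ^ 2 * (L : ℝ) ^ 2 * (radSum d L j x - r))) :=
        hmain
    _ ≤ ((L : ℝ) ^ 2) ^ j * x * (17 / 16) := by
        apply mul_le_mul_of_nonneg_left _ hLj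
        linarith
    _ = 17 / 16 * (((L : ℝ) ^ 2) ^ j * x) := by ring

/-- **THE LOOP RADIUS IN THE COARSE LETTER** (`L ≥ 2`, `x ≥ 0`): `LevelSmall d L j x ⇒ loopRad d L ((prop1Radius d L)^[j] x) ≤ 17(d+1)(d+4)·(L^{j+1})²·x`. [folklore] -/
theorem loopRad_iterate_le_of_levelSmall {L : ℕ} (hL : 2 ≤ L) (j : ℕ) {x : ℝ} (hx : 0 ≤ x) (hs : LevelSmall d L j x) :
    loopRad d L ((prop1Radius d L)^[j] x) ≤ 17 * (((d : ℝ) + 1) * ((d : ℝ) + 4)) * (((L : ℝ) ^ (j + 1)) ^ 2 * x) := by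
  have h := iterate_prop1Radius_le_of_levelSmall hL j hx hs
  have hc : (0 : ℝ) ≤ 2 * (8 * ((d : ℝ) + 1) * ((d : ℝ) + 4) * (L : ℝ) ^ 2) := by positivity
  unfold loopRad
  calc 2 * (8 * ((d : ℝ) + 1) * ((d : ℝ) + 4) * (L : ℝ) ^ 2 * (prop1Radius d L)^[j] x)
      = 2 * (8 * ((d : ℝ) + 1) * ((d : ℝ) + 4) * (L : ℝ) ^ 2) * (prop1Radius d L)^[j] x := by ring
    _ ≤ 2 * (8 * ((d : ℝ) + 1) * ((d : ℝ) + 4) * (L : ℝ) ^ 2) * (17 / 16 * (((L : ℝ) ^ 2) ^ j * x)) :=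
        mul_le_mul_of_nonneg_left h hc
    _ = 17 * (((d : ℝ) + 1) * ((d : ℝ) + 4)) * (((L : ℝ) ^ (j + 1)) ^ 2 * x) := by ring

/-- **`E_j` IN THE COARSE LETTER** (`L ≥ 2`, `x ≥ 0`): `LevelSmall d L j x ⇒
4d²(L^{j+1} − 1)²x + 16d·loopRad d L ((prop1Radius d L)^[j] x) ≤ (4d² + 272d(d+1)(d+4))·(L^{j+1})²·x` — J2's contraction constant
(`NE3NestedBlockMeanBridge.norm_bmeanIterW_sub_bmeanW_le`) is `O(ε)`, k-free, BY NAME. [folklore] -/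
theorem E_le_of_levelSmall {L : ℕ} (hL : 2 ≤ L) (j : ℕ) {x : ℝ} (hx : 0 ≤ x) (hs : LevelSmall d L j x) :
    4 * (d : ℝ) ^ 2 * ((L : ℝ) ^ (j + 1) - 1) ^ 2 * x + 16 * d * loopRad d L ((prop1Radius d L)^[j] x)
      ≤ (4 * (d : ℝ) ^ 2 + 272 * d * (((d : ℝ) + 1) * ((d : ℝ) + 4))) * (((L : ℝ) ^ (j + 1)) ^ 2 * x) := by
  have hl := loopRad_iterate_le_of_levelSmall hL j hx hs
  have hL2 : (2 : ℝ) ≤ L := by exact_mod_cast hL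
  have hL1 : (1 : ℝ) ≤ L := by linarith
  have hp : (1 : ℝ) ≤ (L : ℝ) ^ (j + 1) := one_le_pow₀ hL1
  have hA : ((L : ℝ) ^ (j + 1) - 1) ^ 2 * x ≤ ((L : ℝ) ^ (j + 1)) ^ 2 * x := by
    have h1 : ((L : ℝ) ^ (j + 1) - 1) ^ 2 ≤ ((L : ℝ) ^ (j + 1)) ^ 2 := by nlinarith
    exact mul_le_mul_of_nonneg_right h1 hx
  have hd : (0 : ℝ) ≤ d := Nat.cast_nonneg d
  have hd0 : (0 : ℝ) ≤ 4 * (d : ℝ) ^ 2 := by positivity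
  have hd1 : (0 : ℝ) ≤ 16 * (d : ℝ) := by positivity
  nlinarith [mul_le_mul_of_nonneg_left hA hd0, mul_le_mul_of_nonneg_left hl hd1]

/-! ## §4 One level: the background `cavg L U_B` of the junction speaks `ε` too -/

/-- ONE LEVEL (`L ≥ 2`, `y ≥ 0`): `twoLevelSmall d L·y ≤ 1 ⇒ prop1Radius d L y ≤ (17∕16)·(L²·y)`. [folklore] -/
theorem prop1Radius_le_of_twoLevelSmall {L : ℕ} (hL : 2 ≤ L) {y : ℝ} (hy : 0 ≤ y) (h : twoLevelSmall d L * y ≤ 1) :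
    prop1Radius d L y ≤ 17 / 16 * ((L : ℝ) ^ 2 * y) := by
  rw [prop1Radius_eq_mul]
  unfold twoLevelSmall at h
  have hL2 : (2 : ℝ) ≤ L := by exact_mod_cast hL
  have hL1 : (1 : ℝ) ≤ L := by linarith
  have hLd : (L : ℝ) ^ 2 * 4 ≤ (L : ℝ) ^ (d + 4) := by
    have h4 : (4 : ℝ) ≤ (L : ℝ) ^ 2 := by nlinarith
    have hd2 : (L : ℝ) ^ 2 ≤ (L : ℝ) ^ (d + 2) := pow_le_pow_right₀ hL1 (by omega)
    calc (L : ℝ) ^ 2 * 4 ≤ (L : ℝ) ^ 2 * (L : ℝ) ^ 2 := mul_le_mul_of_nonneg_left h4 (by positivity)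
      _ ≤ (L : ℝ) ^ (d + 2) * (L : ℝ) ^ 2 := mul_le_mul_of_nonneg_right hd2 (by positivity)
      _ = (L : ℝ) ^ (d + 4) := by ring
  have hP0 : (0 : ℝ) ≤ ((d : ℝ) + 1) ^ 2 * ((d : ℝ) + 4) ^ 2 := by positivity
  have hcy : 14464 * ((d : ℝ) + 1) ^ 2 * ((d : ℝ) + 4) ^ 2 * (L : ℝ) ^ 2 * y ≤ 14464 / 262144 := by
    have h1 : ((d : ℝ) + 1) ^ 2 * ((d : ℝ) + 4) ^ 2 * ((L : ℝ) ^ 2 * 4) * y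
        ≤ ((d : ℝ) + 1) ^ 2 * ((d : ℝ) + 4) ^ 2 * (L : ℝ) ^ (d + 4) * y :=
      mul_le_mul_of_nonneg_right (mul_le_mul_of_nonneg_left hLd hP0) hy
    nlinarith [h1, h]
  have hLy : (0 : ℝ) ≤ (L : ℝ) ^ 2 * y := by positivity
  calc (L : ℝ) ^ 2 * y * (1 + 14464 * ((d : ℝ) + 1) ^ 2 * ((d : ℝ) + 4) ^ 2 * (L : ℝ) ^ 2 * y)
      ≤ (L : ℝ) ^ 2 * y * (17 / 16) := mul_le_mul_of_nonneg_left (by linarith) hLy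
    _ = 17 / 16 * ((L : ℝ) ^ 2 * y) := by ring

/-- **THE JUNCTION'S DICTIONARY** (`L ≥ 2`, `ε ≥ 0`, levels `j+1`∕`j+2` of `ne3EnergyRateWSup_sfClass_of_slicePoincare`): the K-road letter
`θ₁ = (L^{j+1})²·x_W` of the background `W = cavg L U_B` (`x_W = prop1Radius d L (ε∕(L^{j+2})²)`, B7 Prop. 1 one level up from run B's
`ε∕(L^{j+2})²`) is at most `(17∕16)·ε` under the two-level smallness of run B's radius (`LevelSmall.two`). [folklore] -/
theorem sq_pow_mul_prop1Radius_le {L : ℕ} (hL : 2 ≤ L) (j : ℕ) {ε : ℝ} (hε : 0 ≤ ε)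
    (h : twoLevelSmall d L * (ε / ((L : ℝ) ^ (j + 2)) ^ 2) ≤ 1) :
    ((L : ℝ) ^ (j + 1)) ^ 2 * prop1Radius d L (ε / ((L : ℝ) ^ (j + 2)) ^ 2) ≤ 17 / 16 * ε := by
  have hL0 : (0 : ℝ) < L := by exact_mod_cast (lt_of_lt_of_le (by norm_num) hL)
  have hP : (0 : ℝ) < ((L : ℝ) ^ (j + 2)) ^ 2 := by positivity
  have hy : 0 ≤ ε / ((L : ℝ) ^ (j + 2)) ^ 2 := div_nonneg hε hP.le
  have h1 := prop1Radius_le_of_twoLevelSmall (d := d) hL hy h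
  have hLj : (0 : ℝ) ≤ ((L : ℝ) ^ (j + 1)) ^ 2 := by positivity
  calc ((L : ℝ) ^ (j + 1)) ^ 2 * prop1Radius d L (ε / ((L : ℝ) ^ (j + 2)) ^ 2)
      ≤ ((L : ℝ) ^ (j + 1)) ^ 2 * (17 / 16 * ((L : ℝ) ^ 2 * (ε / ((L : ℝ) ^ (j + 2)) ^ 2))) := mul_le_mul_of_nonneg_left h1 hLj
    _ = 17 / 16 * ε := by
        have hne : ((L : ℝ) ^ (j + 2)) ^ 2 ≠ 0 := hP.ne'
        field_simp
        ring

end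

end Summit.QuantumFields.BalabanUV.T4Continuum.NE3TopRadiusLetters
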